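import Summits.Parity.GeneralizedHardyLittlewood.Theorems.BeyondDiagonalBeatsQuarter.OffDiagCoreTruncationKit
import HarnessLib

/-!
# Route `PrimeLevelFamEdge`, crux K_B (stmt-Parity-20343), line `diagonal_kernel_split` rev 4, plan Ω,
# support kit for K1 = P8 (T), part 2 `OffDiagCoreTruncationCount`: **`|offDiagNearHead Δ′ q − offDiagCore Hf Δ′ q|
# ≤ (4πq̂/q)·TAIL₁(Hf)` for ANY height function, and the count of the index set for ANY box function**

* **`abs_offDiagNearHead_sub_offDiagCore_le`** — for any `Hf` and `q ≥ 1`: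
  `|offDiagNearHead Δ′ q − offDiagCore Hf Δ′ q| ≤ (4πq̂/q)·Σ_{r<q⁷}Σ_{l,m}|c_lc_m|Σ_{d₁∣l,d₂∣m}Σ_{i near} q(r+1)·Σ_{h∈ℤ²,|h₁|>Hf}‖Φ̂_i(h/(q(r+1)))‖`
  (`offDiagNearHead_eq_dual`, `OffDiagCoreTruncationKit.norm_tsum_sub_trunc_le`);
* **`core_count_le`** — if a nonnegative box function is `≤ B` on the index set then (`q ≥ 40`, `0 < Δ′ ≤ 2`)
  `(4πq̂/q)·Σ_{r,l,m}|c_lc_m|Σ_{d,i} w ≤ 4π·121·q^{13}·B` (`q⁷` layers, `⌊q̂^{Δ′}⌋ ≤ q` twice, `|c_lc_m| ≤ 1`,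
  `τ ≤ q` twice, `#nearBoxes ≤ 121 log²q ≤ 121q²`, `4πq̂/q ≤ 4π`).
With `OffDiagCoreTruncationKit.exists_boxTail_fst_le` (`B = 𝓚_k q^{61}(q^{ε₀})^{−k}`, `k = ⌈74/ε₀⌉+2`) this leaves
for (T) only `q^{74} ≤ (q^{ε₀})^k` and `PeterssonSplit.exists_qhat_rpow_le_mul_mainScaleReal`, verbatim as in
`OffDiagCoreLedger.abs_offDiagCore_le`. Bookkeeping; nothing about the heart. Helper (`--supports stmt-Parity-20343`);
standard axioms.
«The programme SEARCHES and TYPES; no claim about Landau–Siegel zeros, Theorems 1–2 of arXiv:2211.02515 or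
a repaired Margin232 until a kernel theorem says so.»
-/

noncomputable section

open Finset Polynomial
open scoped Real

namespace Summit.Parity.GeneralizedHardyLittlewood.Theorems.BeyondDiagonalBeatsQuarter.OffDiag

open Literature.NumberTheory.LFunctions Literature.NumberTheory.LFunctions.KMV2000
open Literature.NumberTheory.Sieve.FriedlanderIwaniecPrimes (fourier2)
open PeterssonSplit (nearBoxes two_pi_mul_qhat_sq qhat_sq_le)

/-! ### §3. `|nearHead − core| ≤ (4πq̂/q)·TAIL₁` and the count for any box function -/

/-- **`|offDiagNearHead Δ′ q − offDiagCore Hf Δ′ q| ≤ (4πq̂/q)·TAIL₁(Hf)`** for any height function `Hf`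
(`q ≥ 1`): the near head is the complete dual series box by box (`offDiagNearHead_eq_dual`), the core its
`|h₁| ≤ Hf` truncation; triangle inequality through the finite sums and `norm_tsum_sub_trunc_le`.
[cite: KowalskiMichelVanderKam2000, (21)–(23) p. 12 — derivation] -/
theorem abs_offDiagNearHead_sub_offDiagCore_le {q : ℕ} [NeZero q]
    (Hf : ℕ → ℕ → ℕ → ℕ → ℕ → ℕ → ℕ × ℕ → ℕ) (Δ' : ℝ) :
    |offDiagNearHead Δ' q - offDiagCore Hf Δ' q| ≤ 4 * π * qhat q / q *
      ∑ r ∈ Finset.range (q ^ 7), ∑ l ∈ Finset.Icc 1 ⌊qhat q ^ Δ'⌋₊, ∑ m ∈ Finset.Icc 1 ⌊qhat q ^ Δ'⌋₊,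
        |mollifierCoeff (X ^ 2) (qhat q ^ Δ') l * mollifierCoeff (X ^ 2) (qhat q ^ Δ') m| *
          ∑ d₁ ∈ l.divisors, ∑ d₂ ∈ m.divisors, ∑ i ∈ nearBoxes q d₁ d₂ (Real.log q ^ 4),
            ((q * (r + 1) : ℕ) : ℝ) * ∑' h : ℤ × ℤ,
              (if (Hf q d₁ d₂ (l / d₁) (m / d₂) (r + 1) i : ℤ) < |h.1| then
                ‖fourier2 (boxWeight q d₁ d₂ (l / d₁) (m / d₂) (r + 1) i) (h.1 / (q * (r + 1) : ℕ))
                  (h.2 / (q * (r + 1) : ℕ))‖ else 0) := by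
  classical
  rw [offDiagNearHead_eq_dual]
  unfold offDiagCore
  rw [dif_neg (NeZero.ne q)]
  have hpre : ‖(2 * (qhat q : ℂ) * (2 * π / q))‖ = 4 * π * qhat q / q := by
    have hs0 : 0 ≤ qhat q := (qhat_pos_of_neZero q).le
    rw [show (2 * (qhat q : ℂ) * (2 * π / q)) = ((4 * π * qhat q / q : ℝ) : ℂ) by push_cast; ring,
      Complex.norm_real, Real.norm_of_nonneg (by positivity)]
  rw [neg_sub_neg, ← Complex.sub_re, ← mul_sub]
  refine (Complex.abs_re_le_norm _).trans ?_
  rw [norm_mul, hpre]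
  refine mul_le_mul_of_nonneg_left ?_ (by
    have hs0 : 0 ≤ qhat q := (qhat_pos_of_neZero q).le
    positivity)
  rw [← Finset.sum_sub_distrib]
  refine (norm_sum_le _ _).trans (Finset.sum_le_sum fun r _ ↦ ?_)
  rw [← Finset.sum_sub_distrib]
  refine (norm_sum_le _ _).trans (Finset.sum_le_sum fun l hl ↦ ?_)
  rw [← Finset.sum_sub_distrib]
  refine (norm_sum_le _ _).trans (Finset.sum_le_sum fun m hm ↦ ?_)
  rw [← mul_sub, norm_mul, Complex.norm_real, Real.norm_eq_abs]
  refine mul_le_mul_of_nonneg_left ?_ (abs_nonneg _)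
  rw [← Finset.sum_sub_distrib]
  refine (norm_sum_le _ _).trans (Finset.sum_le_sum fun d₁ hd₁ ↦ ?_)
  rw [← Finset.sum_sub_distrib]
  refine (norm_sum_le _ _).trans (Finset.sum_le_sum fun d₂ hd₂ ↦ ?_)
  rw [← Finset.sum_sub_distrib]
  refine (norm_sum_le _ _).trans (Finset.sum_le_sum fun i _ ↦ ?_)
  have hl1 : 1 ≤ l := (Finset.mem_Icc.mp hl).1
  have hm1 : 1 ≤ m := (Finset.mem_Icc.mp hm).1
  rw [norm_sub_rev]
  exact norm_tsum_sub_trunc_le (q := q) (Nat.pos_of_mem_divisors hd₁) (Nat.pos_of_mem_divisors hd₂)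
    (OffDiagDual.one_le_div_of_dvd (Nat.dvd_of_mem_divisors hd₁) hl1)
    (OffDiagDual.one_le_div_of_dvd (Nat.dvd_of_mem_divisors hd₂) hm1) (r + 1) i _

/-- **Counting, for any box function.** If `0 ≤ w ≤ B` on the index set of the finite dual core, then for
`q ≥ 40`, `0 < Δ′ ≤ 2`: `(4πq̂/q)·Σ_{r<q⁷}Σ_{l,m}|c_lc_m|Σ_{d₁∣l,d₂∣m}Σ_{i near} w ≤ 4π·121·q^{13}·B`.
[cite: KowalskiMichelVanderKam2000, (21)–(23) p. 12 — derivation] -/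
theorem core_count_le {q : ℕ} [NeZero q] (hq : 40 ≤ q) {Δ' : ℝ} (h0 : 0 < Δ') (h2 : Δ' ≤ 2)
    (w : ℕ → ℕ → ℕ → ℕ → ℕ → ℕ × ℕ → ℝ) (hw : ∀ r l m d₁ d₂ i, 0 ≤ w r l m d₁ d₂ i) {B : ℝ} (hB : 0 ≤ B)
    (hbox : ∀ r ∈ Finset.range (q ^ 7), ∀ l ∈ Finset.Icc 1 ⌊qhat q ^ Δ'⌋₊, ∀ m ∈ Finset.Icc 1 ⌊qhat q ^ Δ'⌋₊,
      ∀ d₁ ∈ l.divisors, ∀ d₂ ∈ m.divisors, ∀ i ∈ nearBoxes q d₁ d₂ (Real.log q ^ 4),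
        w r l m d₁ d₂ i ≤ B) :
    4 * π * qhat q / q *
      ∑ r ∈ Finset.range (q ^ 7), ∑ l ∈ Finset.Icc 1 ⌊qhat q ^ Δ'⌋₊, ∑ m ∈ Finset.Icc 1 ⌊qhat q ^ Δ'⌋₊,
        |mollifierCoeff (X ^ 2) (qhat q ^ Δ') l * mollifierCoeff (X ^ 2) (qhat q ^ Δ') m| *
          ∑ d₁ ∈ l.divisors, ∑ d₂ ∈ m.divisors, ∑ i ∈ nearBoxes q d₁ d₂ (Real.log q ^ 4), w r l m d₁ d₂ i ≤
      4 * π * (121 * (q : ℝ) ^ 13 * B) := by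
  set s : ℝ := qhat q with hs
  set L : ℝ := Real.log q with hL
  set M : ℝ := s ^ Δ' with hM
  have hs1 : 1 < s := one_lt_qhat hq
  have hs0 : 0 < s := lt_trans one_pos hs1
  have hq0 : (0 : ℝ) < q := by exact_mod_cast (show 0 < q by omega)
  have hL0 : 0 < L := lt_of_lt_of_le one_pos (one_le_log hq)
  have hL_le_q : L ≤ (q : ℝ) := (Real.log_le_sub_one_of_pos hq0).trans (by linarith)
  have hsq : s ^ 2 ≤ (q : ℝ) := qhat_sq_le q
  have hM1 : 1 < M := Real.one_lt_rpow hs1 h0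
  have hMq : M ≤ (q : ℝ) := by
    calc M ≤ s ^ (2 : ℝ) := Real.rpow_le_rpow_of_exponent_le hs1.le h2
      _ = s ^ 2 := by rw [show (2 : ℝ) = (2 : ℕ) by norm_num, Real.rpow_natCast]
      _ ≤ q := hsq
  have hfloor : (⌊M⌋₊ : ℝ) ≤ q := (Nat.floor_le (by positivity)).trans hMq
  have hpre : 4 * π * s / q ≤ 4 * π := by
    rw [div_le_iff₀ hq0]
    have : s ≤ (q : ℝ) := le_trans (by nlinarith) hsq
    nlinarith [Real.pi_pos]
  have hX : ∀ t ∈ Set.Icc (0 : ℝ) 1, |(X ^ 2 : ℝ[X]).eval t| ≤ 1 := by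
    intro t ht
    rw [eval_pow, eval_X, abs_pow, abs_of_nonneg ht.1]
    exact pow_le_one₀ ht.1 ht.2
  have hcoef : ∀ l ∈ Finset.Icc 1 ⌊M⌋₊, |mollifierCoeff (X ^ 2) M l| ≤ 1 := by
    intro l hl
    have hl1 : (1 : ℝ) ≤ l := by exact_mod_cast (Finset.mem_Icc.mp hl).1
    have h := KMV2000.abs_mollifierCoeff_le hX hM1 hl
    rw [← KMV2000.mollifierCoeff] at h
    calc _ ≤ 1 * (l : ℝ) ^ (-(1 / 2 : ℝ)) := h
      _ ≤ 1 * 1 := by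
          gcongr
          exact Real.rpow_le_one_of_one_le_of_nonpos hl1 (by norm_num)
      _ = 1 := one_mul _
  have hnear : ∀ {d₁ d₂ : ℕ}, 1 ≤ d₁ → 1 ≤ d₂ →
      ((nearBoxes q d₁ d₂ (L ^ 4)).card : ℝ) ≤ 121 * (q : ℝ) ^ 2 := by
    intro d₁ d₂ hd₁ hd₂
    have hc := card_nearBoxes_le (q := q) (d₁ := d₁) (d₂ := d₂) (Nat.mul_pos hd₁ hd₂) (L ^ 4)
    have hN := natLog_floor_sq_le hq
    rw [← hs, ← hL] at hN
    calc ((nearBoxes q d₁ d₂ (L ^ 4)).card : ℝ) ≤ (((Nat.log 2 ⌊4 * s ^ 2 * L ^ 4⌋₊ + 1) ^ 2 : ℕ) : ℝ) := by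
          exact_mod_cast hc
      _ ≤ 121 * L ^ 2 := hN
      _ ≤ 121 * (q : ℝ) ^ 2 := by gcongr
  have hinner : ∀ r ∈ Finset.range (q ^ 7), ∀ l ∈ Finset.Icc 1 ⌊M⌋₊, ∀ m ∈ Finset.Icc 1 ⌊M⌋₊,
      |mollifierCoeff (X ^ 2) M l * mollifierCoeff (X ^ 2) M m| *
          ∑ d₁ ∈ l.divisors, ∑ d₂ ∈ m.divisors, ∑ i ∈ nearBoxes q d₁ d₂ (L ^ 4), w r l m d₁ d₂ i ≤
        (q : ℝ) * ((q : ℝ) * (121 * (q : ℝ) ^ 2 * B)) := by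
    intro r hr l hl m hm
    have hlq : (l : ℝ) ≤ q := le_trans (by exact_mod_cast (Finset.mem_Icc.mp hl).2) hfloor
    have hmq : (m : ℝ) ≤ q := le_trans (by exact_mod_cast (Finset.mem_Icc.mp hm).2) hfloor
    have hcc : |mollifierCoeff (X ^ 2) M l * mollifierCoeff (X ^ 2) M m| ≤ 1 := by
      rw [abs_mul]
      calc _ ≤ 1 * 1 := mul_le_mul (hcoef l hl) (hcoef m hm) (abs_nonneg _) zero_le_one
        _ = 1 := one_mul _
    have hd1sum : ∀ d₁ ∈ l.divisors, ∑ d₂ ∈ m.divisors, ∑ i ∈ nearBoxes q d₁ d₂ (L ^ 4), w r l m d₁ d₂ i ≤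
        (q : ℝ) * (121 * (q : ℝ) ^ 2 * B) := by
      intro d₁ hd₁
      have hd2sum : ∀ d₂ ∈ m.divisors, ∑ i ∈ nearBoxes q d₁ d₂ (L ^ 4), w r l m d₁ d₂ i ≤
          121 * (q : ℝ) ^ 2 * B := by
        intro d₂ hd₂
        calc _ ≤ ((nearBoxes q d₁ d₂ (L ^ 4)).card : ℝ) * B := by
              rw [← nsmul_eq_mul]
              exact Finset.sum_le_card_nsmul _ _ _ fun i hi ↦ hbox r hr l hl m hm d₁ hd₁ d₂ hd₂ i hi
          _ ≤ 121 * (q : ℝ) ^ 2 * B :=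
              mul_le_mul_of_nonneg_right (hnear (Nat.pos_of_mem_divisors hd₁) (Nat.pos_of_mem_divisors hd₂)) hB
      calc _ ≤ (m.divisors.card : ℝ) * (121 * (q : ℝ) ^ 2 * B) := by
            rw [← nsmul_eq_mul]; exact Finset.sum_le_card_nsmul _ _ _ hd2sum
        _ ≤ (q : ℝ) * (121 * (q : ℝ) ^ 2 * B) := by
            refine mul_le_mul_of_nonneg_right ?_ (by positivity)
            exact le_trans (by exact_mod_cast Nat.card_divisors_le_self m) hmq
    have hS : ∑ d₁ ∈ l.divisors, ∑ d₂ ∈ m.divisors, ∑ i ∈ nearBoxes q d₁ d₂ (L ^ 4), w r l m d₁ d₂ i ≤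
        (q : ℝ) * ((q : ℝ) * (121 * (q : ℝ) ^ 2 * B)) := by
      calc _ ≤ (l.divisors.card : ℝ) * ((q : ℝ) * (121 * (q : ℝ) ^ 2 * B)) := by
            rw [← nsmul_eq_mul]; exact Finset.sum_le_card_nsmul _ _ _ hd1sum
        _ ≤ (q : ℝ) * ((q : ℝ) * (121 * (q : ℝ) ^ 2 * B)) := by
            refine mul_le_mul_of_nonneg_right ?_ (by positivity)
            exact le_trans (by exact_mod_cast Nat.card_divisors_le_self l) hlq
    have hS0 : 0 ≤ ∑ d₁ ∈ l.divisors, ∑ d₂ ∈ m.divisors, ∑ i ∈ nearBoxes q d₁ d₂ (L ^ 4), w r l m d₁ d₂ i :=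
      Finset.sum_nonneg fun _ _ ↦ Finset.sum_nonneg fun _ _ ↦ Finset.sum_nonneg fun _ _ ↦ hw _ _ _ _ _ _
    calc _ ≤ 1 * ((q : ℝ) * ((q : ℝ) * (121 * (q : ℝ) ^ 2 * B))) := mul_le_mul hcc hS hS0 zero_le_one
      _ = _ := one_mul _
  have hcardI : ((Finset.Icc 1 ⌊M⌋₊).card : ℝ) ≤ q := by
    rw [Nat.card_Icc]; push_cast
    have : ((⌊M⌋₊ + 1 - 1 : ℕ) : ℝ) = ⌊M⌋₊ := by simp
    linarith [hfloor, this]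
  have hm_sum : ∀ r ∈ Finset.range (q ^ 7), ∀ l ∈ Finset.Icc 1 ⌊M⌋₊,
      ∑ m ∈ Finset.Icc 1 ⌊M⌋₊, |mollifierCoeff (X ^ 2) M l * mollifierCoeff (X ^ 2) M m| *
          ∑ d₁ ∈ l.divisors, ∑ d₂ ∈ m.divisors, ∑ i ∈ nearBoxes q d₁ d₂ (L ^ 4), w r l m d₁ d₂ i ≤
        (q : ℝ) * ((q : ℝ) * ((q : ℝ) * (121 * (q : ℝ) ^ 2 * B))) := by
    intro r hr l hl
    calc _ ≤ ((Finset.Icc 1 ⌊M⌋₊).card : ℝ) * ((q : ℝ) * ((q : ℝ) * (121 * (q : ℝ) ^ 2 * B))) := by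
          rw [← nsmul_eq_mul]; exact Finset.sum_le_card_nsmul _ _ _ fun m hm ↦ hinner r hr l hl m hm
      _ ≤ _ := mul_le_mul_of_nonneg_right hcardI (by positivity)
  have hl_sum : ∀ r ∈ Finset.range (q ^ 7),
      ∑ l ∈ Finset.Icc 1 ⌊M⌋₊, ∑ m ∈ Finset.Icc 1 ⌊M⌋₊,
        |mollifierCoeff (X ^ 2) M l * mollifierCoeff (X ^ 2) M m| *
          ∑ d₁ ∈ l.divisors, ∑ d₂ ∈ m.divisors, ∑ i ∈ nearBoxes q d₁ d₂ (L ^ 4), w r l m d₁ d₂ i ≤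
        (q : ℝ) * ((q : ℝ) * ((q : ℝ) * ((q : ℝ) * (121 * (q : ℝ) ^ 2 * B)))) := by
    intro r hr
    calc _ ≤ ((Finset.Icc 1 ⌊M⌋₊).card : ℝ) * ((q : ℝ) * ((q : ℝ) * ((q : ℝ) * (121 * (q : ℝ) ^ 2 * B)))) := by
          rw [← nsmul_eq_mul]; exact Finset.sum_le_card_nsmul _ _ _ fun l hl ↦ hm_sum r hr l hl
      _ ≤ _ := mul_le_mul_of_nonneg_right hcardI (by positivity)
  have hr_sum : ∑ r ∈ Finset.range (q ^ 7), ∑ l ∈ Finset.Icc 1 ⌊M⌋₊, ∑ m ∈ Finset.Icc 1 ⌊M⌋₊,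
        |mollifierCoeff (X ^ 2) M l * mollifierCoeff (X ^ 2) M m| *
          ∑ d₁ ∈ l.divisors, ∑ d₂ ∈ m.divisors, ∑ i ∈ nearBoxes q d₁ d₂ (L ^ 4), w r l m d₁ d₂ i ≤
        ((q ^ 7 : ℕ) : ℝ) * ((q : ℝ) * ((q : ℝ) * ((q : ℝ) * ((q : ℝ) * (121 * (q : ℝ) ^ 2 * B))))) := by
    calc _ ≤ ((Finset.range (q ^ 7)).card : ℝ) *
          ((q : ℝ) * ((q : ℝ) * ((q : ℝ) * ((q : ℝ) * (121 * (q : ℝ) ^ 2 * B))))) := by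
          rw [← nsmul_eq_mul]; exact Finset.sum_le_card_nsmul _ _ _ hl_sum
      _ = _ := by rw [Finset.card_range]
  have htot0 : 0 ≤ ∑ r ∈ Finset.range (q ^ 7), ∑ l ∈ Finset.Icc 1 ⌊M⌋₊, ∑ m ∈ Finset.Icc 1 ⌊M⌋₊,
        |mollifierCoeff (X ^ 2) M l * mollifierCoeff (X ^ 2) M m| *
          ∑ d₁ ∈ l.divisors, ∑ d₂ ∈ m.divisors, ∑ i ∈ nearBoxes q d₁ d₂ (L ^ 4), w r l m d₁ d₂ i :=
    Finset.sum_nonneg fun _ _ ↦ Finset.sum_nonneg fun _ _ ↦ Finset.sum_nonneg fun _ _ ↦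
      mul_nonneg (abs_nonneg _) (Finset.sum_nonneg fun _ _ ↦ Finset.sum_nonneg fun _ _ ↦
        Finset.sum_nonneg fun _ _ ↦ hw _ _ _ _ _ _)
  calc _ ≤ (4 * π) * (((q ^ 7 : ℕ) : ℝ) * ((q : ℝ) * ((q : ℝ) * ((q : ℝ) * ((q : ℝ) *
        (121 * (q : ℝ) ^ 2 * B)))))) := mul_le_mul hpre hr_sum htot0 (by positivity)
    _ = 4 * π * (121 * (q : ℝ) ^ 13 * B) := by push_cast; ring

end Summit.Parity.GeneralizedHardyLittlewood.Theorems.BeyondDiagonalBeatsQuarter.OffDiag
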